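import Literature.AlgebraicGeometry.Motives.MixedHodgeExtensionHomFunctorNaturality
import Literature.AlgebraicGeometry.Motives.MixedHodgeExtensionHomFunctorClass
import HarnessLib

/-!
# `Hom(ℚ(n), E) ≅ E(−n)` and `Hom(E, ℚ(n)) ≅ E^∨(n)` for extensions of mixed Hodge structures

Deligne, *Théorie de Hodge II*, 2.1.13: the Tate twist `H(n) = H ⊗ ℤ(n)`; 1.1.12: the internal `Hom`;
so `Hom(ℚ(n), H) = ℚ(n)^∨ ⊗ H = ℚ(−n) ⊗ H = H(−n)` and `Hom(H, ℚ(n)) = H^∨ ⊗ ℚ(n) = H^∨(n)`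
(Cattani–El Zein–Griffiths–Lê Ex. 3.2.23 (4): twists of mixed Hodge structures; Deligne–Milne (1.6.4):
`Hom(1, X) = X`). Carlson, *Extensions of mixed Hodge structures* (1980), §2(c) Remark (3): the dual
extension. Mac Lane, *Homology* III Prop. 1.8: `β_* E ≡ α^* E'` along a morphism of extensions.

In the tree `hom (H₁.tateTwist j) H₂ = (hom H₁ H₂).tateTwist (-j)` and `hom H₁ (H₂.tateTwist j) =
(hom H₁ H₂).tateTwist j` (`MixedHodgeStructureInternalHom`), `hom H ℚ(0) = H^∨`
(`hom_unit_eq_dual`) and `ℚ(-p)(n) = ℚ(-(p - n))` (`tate_toMixedHodgeStructure_tateTwist`) hold as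
EQUALITIES of mixed Hodge structures. This file deduces, for an extension `E : 0 → B → E → A → 0`
(finite-dimensional carriers) and `n : ℤ`:

* §1 `ℚ(n) = ℚ(0)(n)`, **`Hom(ℚ(n), X) = Hom(ℚ(0), X)(−n)`**, **`Hom(X, ℚ(n)) = X^∨(n)`** (equalities of
  MHS), the isomorphisms of MHS `Hom(ℚ(n), X) → X(−n)`, `f ↦ f(1)` (`homTateToTwist`, inverse
  `twistToHomTate`) and `Hom(X, ℚ(n)) → X^∨(n)` (the identity of `X →ₗ ℚ`, `homTateRightToDualTwist`);
* §2 the isomorphisms of extensions **`Hom(ℚ(n), E) → E(−n)`** (`Extension.homLeftTateToTwist`) and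
  **`Hom(E, ℚ(n)) → E^∨(n)`** (`Extension.homRightTateToDualTwist`), with Mac Lane's congruences and
  `Hom(ℚ(n), E)` splits iff `E` splits iff `Hom(E, ℚ(n))` splits;
* §3 on `Ext`: **`(≅)_* Hom(ℚ(n), x) = (≅)^* x(−n)`**, `Hom(ℚ(n), x) = (≅)^* (≅⁻¹)_* x(−n)`,
  **`(≅)_* Hom(x, ℚ(n)) = (≅)^* x^∨(n)`**, `Hom(x, ℚ(n)) = (≅⁻¹)_* (≅)^* x^∨(n)`
  (`x(m) = Ext.tateTwistEquiv m x`, `x^∨ = Ext.dualEquivW x`), and `Hom(ℚ(n), −)`, `Hom(−, ℚ(n))` are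
  injective on `Ext(A, B)` and detect the split class.

All statements proved; no named facts.

## References

* [DeligneHodgeII1971] P. Deligne, Théorie de Hodge II, 1.1.12, 2.1.13.
* [CattaniElZeinGriffithsLe2014] E. Cattani et al. (eds.), Hodge Theory (2014), Ex. 3.2.23 (4), p. 163;
  §3.2.2.7.
* [DeligneMilne1982Tannakian] P. Deligne, J. S. Milne, Tannakian categories, LNM 900 (1982), §1 (1.6.4).
* [Carlson1980] J. A. Carlson, Extensions of mixed Hodge structures (1980), §2(c) Remark (3).
* [MacLane1963Homology] S. Mac Lane, Homology (1963), Ch. III §1 Prop. 1.8.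
-/

noncomputable section

open scoped TensorProduct

namespace Literature.AlgebraicGeometry.Motives

namespace MixedHodgeStructure

open HodgeStructure (tate)

/-! ### §1 `Hom(ℚ(n), X) = Hom(ℚ(0), X)(−n) ≅ X(−n)` and `Hom(X, ℚ(n)) = X^∨(n)` -/

section MHS

variable {V : Type*} [AddCommGroup V] [Module ℚ V] [FiniteDimensional ℚ V] (X : MixedHodgeStructure V) (n : ℤ)

/-- **`ℚ(n) = ℚ(0)(n)`** as mixed Hodge structures on the line `ℚ`. [cite: CattaniElZeinGriffithsLe2014, Ex. 3.2.23 (4), p. 163] -/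
theorem tate_toMixedHodgeStructure_eq_unit_tateTwist :
    (tate n).toMixedHodgeStructure = (tate 0).toMixedHodgeStructure.tateTwist n := by
  have h := tate_toMixedHodgeStructure_tateTwist 0 n
  rw [zero_sub, neg_neg] at h
  exact h.symm

/-- **`Hom(ℚ(n), X) = Hom(ℚ(0), X)(−n)`** as mixed Hodge structures on `ℚ →ₗ V`.
[cite: DeligneHodgeII1971, 1.1.12] [cite: CattaniElZeinGriffithsLe2014, Ex. 3.2.23 (4), p. 163] -/
theorem hom_tate_left_eq :
    hom (tate n).toMixedHodgeStructure X = (hom (tate 0).toMixedHodgeStructure X).tateTwist (-n) := by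
  rw [tate_toMixedHodgeStructure_eq_unit_tateTwist, hom_tateTwist_left]

/-- **`Hom(X, ℚ(n)) = X^∨(n)`** as mixed Hodge structures on `V →ₗ ℚ = V^∨`.
[cite: DeligneHodgeII1971, 1.1.12] [cite: Carlson1980, §2(c) Remark (3)] -/
theorem hom_tate_right_eq : hom X (tate n).toMixedHodgeStructure = X.dual.tateTwist n := by
  rw [tate_toMixedHodgeStructure_eq_unit_tateTwist, hom_tateTwist_right, hom_unit_eq_dual]

/-- **The isomorphism of MHS `Hom(ℚ(n), X) → X(−n)`, `f ↦ f(1)`** (`Hom(ℚ(n), X) = Hom(ℚ(0), X)(−n)`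
followed by the twist of `unitHomEval : Hom(ℚ(0), X) ≅ X`). [cite: DeligneMilne1982Tannakian, §1 (1.6.4)]
[cite: DeligneHodgeII1971, 2.1.13] -/
def homTateToTwist : Hom (hom (tate n).toMixedHodgeStructure X) (X.tateTwist (-n)) :=
  ((unitHomEval X).tateTwist (-n)).comp (Hom.ofEq (hom_tate_left_eq X n))

/-- `homTateToTwist f = f(1)` (by `rfl`). [cite: DeligneMilne1982Tannakian, §1 (1.6.4)] -/
@[simp]
theorem homTateToTwist_toLinearMap_apply (f : ℚ →ₗ[ℚ] V) : (homTateToTwist X n).toLinearMap f = f 1 := rfl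

/-- **The inverse isomorphism `X(−n) → Hom(ℚ(n), X)`, `v ↦ (q ↦ q • v)`.** [cite: DeligneMilne1982Tannakian, §1 (1.6.4)] -/
def twistToHomTate : Hom (X.tateTwist (-n)) (hom (tate n).toMixedHodgeStructure X) :=
  (Hom.ofEq (hom_tate_left_eq X n).symm).comp ((unitHomEvalInv X).tateTwist (-n))

/-- `twistToHomTate v = unitHomEvalInv v` on underlying maps (by `rfl`). [cite: DeligneMilne1982Tannakian, §1 (1.6.4)] -/
theorem twistToHomTate_toLinearMap_apply (v : V) :
    (twistToHomTate X n).toLinearMap v = (unitHomEvalInv X).toLinearMap v := rfl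

/-- `twistToHomTate ∘ homTateToTwist = id`. [cite: DeligneMilne1982Tannakian, §1 (1.6.4)] -/
theorem twistToHomTate_comp_homTateToTwist :
    (twistToHomTate X n).comp (homTateToTwist X n) = Hom.id (hom (tate n).toMixedHodgeStructure X) :=
  Hom.ext (LinearMap.ext fun f => by
    have h := congrArg (fun φ : Hom _ _ => φ.toLinearMap f) (unitHomEvalInv_comp_unitHomEval X)
    exact h)

/-- `homTateToTwist ∘ twistToHomTate = id`. [cite: DeligneMilne1982Tannakian, §1 (1.6.4)] -/
theorem homTateToTwist_comp_twistToHomTate :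
    (homTateToTwist X n).comp (twistToHomTate X n) = Hom.id (X.tateTwist (-n)) :=
  Hom.ext (LinearMap.ext fun v => by
    have h := congrArg (fun φ : Hom X X => φ.toLinearMap v) (unitHomEval_comp_unitHomEvalInv X)
    exact h)

/-- **The isomorphism of MHS `Hom(X, ℚ(n)) → X^∨(n)`** (the identity of `V →ₗ ℚ`, transporting along
`Hom(X, ℚ(n)) = X^∨(n)`). [cite: Carlson1980, §2(c) Remark (3)] [cite: DeligneHodgeII1971, 2.1.13] -/
def homTateRightToDualTwist : Hom (hom X (tate n).toMixedHodgeStructure) (X.dual.tateTwist n) :=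
  Hom.ofEq (hom_tate_right_eq X n)

/-- `homTateRightToDualTwist` is the identity on underlying maps (by `rfl`). [cite: Carlson1980, §2(c) Remark (3)] -/
@[simp]
theorem homTateRightToDualTwist_toLinearMap_apply (f : V →ₗ[ℚ] ℚ) :
    (homTateRightToDualTwist X n).toLinearMap f = f := rfl

/-- **The inverse isomorphism `X^∨(n) → Hom(X, ℚ(n))`** (identity on underlying maps). [cite: Carlson1980, §2(c) Remark (3)] -/
def dualTwistToHomTateRight : Hom (X.dual.tateTwist n) (hom X (tate n).toMixedHodgeStructure) :=
  Hom.ofEq (hom_tate_right_eq X n).symm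

/-- `dualTwistToHomTateRight` is the identity on underlying maps (by `rfl`). [cite: Carlson1980, §2(c) Remark (3)] -/
@[simp]
theorem dualTwistToHomTateRight_toLinearMap_apply (φ : Module.Dual ℚ V) :
    (dualTwistToHomTateRight X n).toLinearMap φ = φ := rfl

/-- `dualTwistToHomTateRight ∘ homTateRightToDualTwist = id`. [cite: Carlson1980, §2(c) Remark (3)] -/
theorem dualTwistToHomTateRight_comp_homTateRightToDualTwist :
    (dualTwistToHomTateRight X n).comp (homTateRightToDualTwist X n) =
      Hom.id (hom X (tate n).toMixedHodgeStructure) :=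
  Hom.ext rfl

/-- `homTateRightToDualTwist ∘ dualTwistToHomTateRight = id`. [cite: Carlson1980, §2(c) Remark (3)] -/
theorem homTateRightToDualTwist_comp_dualTwistToHomTateRight :
    (homTateRightToDualTwist X n).comp (dualTwistToHomTateRight X n) = Hom.id (X.dual.tateTwist n) :=
  Hom.ext rfl

end MHS

/-! ### §2 The isomorphisms of extensions `Hom(ℚ(n), E) → E(−n)` and `Hom(E, ℚ(n)) → E^∨(n)` -/

section Extensions

variable {VA : Type*} [AddCommGroup VA] [Module ℚ VA] [FiniteDimensional ℚ VA]
variable {VB : Type*} [AddCommGroup VB] [Module ℚ VB] [FiniteDimensional ℚ VB]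
variable {VE : Type*} [AddCommGroup VE] [Module ℚ VE] [FiniteDimensional ℚ VE]
variable {A : MixedHodgeStructure VA} {B : MixedHodgeStructure VB}

namespace Extension

variable (E : Extension A B VE) (n : ℤ)

/-- **The isomorphism of extensions `Hom(ℚ(n), E) → E(−n)`** over `Hom(ℚ(n), B) ≅ B(−n)`,
`Hom(ℚ(n), A) ≅ A(−n)` (components `homTateToTwist`, `f ↦ f(1)`: `(i ∘ f)(1) = i(f(1))`).
[cite: DeligneHodgeII1971, 2.1.13] [cite: DeligneMilne1982Tannakian, §1 (1.6.4)] -/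
def homLeftTateToTwist : Morphism (E.homLeft (tate n).toMixedHodgeStructure) (E.tateTwist (-n)) where
  left := homTateToTwist B n
  mid := homTateToTwist E.mhs n
  right := homTateToTwist A n
  mid_inc := by
    change (homTateToTwist E.mhs n).toLinearMap ∘ₗ
        (Hom.homMap (Hom.id (tate n).toMixedHodgeStructure) E.inc).toLinearMap =
      E.inc.toLinearMap ∘ₗ (homTateToTwist B n).toLinearMap
    refine LinearMap.ext fun f => ?_
    simp only [LinearMap.comp_apply, homTateToTwist_toLinearMap_apply, Hom.homMap_toLinearMap_apply,
      Hom.id_toLinearMap, LinearMap.comp_id]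
  proj_mid := by
    change E.proj.toLinearMap ∘ₗ (homTateToTwist E.mhs n).toLinearMap =
      (homTateToTwist A n).toLinearMap ∘ₗ
        (Hom.homMap (Hom.id (tate n).toMixedHodgeStructure) E.proj).toLinearMap
    refine LinearMap.ext fun f => ?_
    simp only [LinearMap.comp_apply, homTateToTwist_toLinearMap_apply, Hom.homMap_toLinearMap_apply,
      Hom.id_toLinearMap, LinearMap.comp_id]

/-- Components of `Hom(ℚ(n), E) → E(−n)` (by `rfl`). [cite: DeligneHodgeII1971, 2.1.13] -/
@[simp]
theorem homLeftTateToTwist_left : (E.homLeftTateToTwist n).left = homTateToTwist B n := rfl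

/-- Components of `Hom(ℚ(n), E) → E(−n)` (by `rfl`). [cite: DeligneHodgeII1971, 2.1.13] -/
@[simp]
theorem homLeftTateToTwist_right : (E.homLeftTateToTwist n).right = homTateToTwist A n := rfl

/-- **The isomorphism of extensions `Hom(E, ℚ(n)) → E^∨(n)`** over `Hom(A, ℚ(n)) = A^∨(n)`,
`Hom(B, ℚ(n)) = B^∨(n)` (identity components; squares `id ∘ f ∘ π = ᵗπ(f)`, `id ∘ g ∘ i = ᵗi(g)`).
[cite: Carlson1980, §2(c) Remark (3)] [cite: DeligneHodgeII1971, 2.1.13] -/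
def homRightTateToDualTwist :
    Morphism (E.homRight (tate n).toMixedHodgeStructure) (E.dual.tateTwist n) where
  left := homTateRightToDualTwist A n
  mid := homTateRightToDualTwist E.mhs n
  right := homTateRightToDualTwist B n
  mid_inc := by
    change (homTateRightToDualTwist E.mhs n).toLinearMap ∘ₗ
        (Hom.homMap E.proj (Hom.id (tate n).toMixedHodgeStructure)).toLinearMap =
      (E.proj.transpose.tateTwist n).toLinearMap ∘ₗ (homTateRightToDualTwist A n).toLinearMap
    refine LinearMap.ext fun f => ?_
    simp only [LinearMap.comp_apply, homTateRightToDualTwist_toLinearMap_apply, Hom.homMap_toLinearMap_apply,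
      Hom.id_toLinearMap, LinearMap.id_comp, Hom.tateTwist_toLinearMap, Hom.transpose_toLinearMap,
      LinearMap.dualMap_apply']
  proj_mid := by
    change (E.inc.transpose.tateTwist n).toLinearMap ∘ₗ (homTateRightToDualTwist E.mhs n).toLinearMap =
      (homTateRightToDualTwist B n).toLinearMap ∘ₗ
        (Hom.homMap E.inc (Hom.id (tate n).toMixedHodgeStructure)).toLinearMap
    refine LinearMap.ext fun f => ?_
    simp only [LinearMap.comp_apply, homTateRightToDualTwist_toLinearMap_apply, Hom.homMap_toLinearMap_apply,
      Hom.id_toLinearMap, LinearMap.id_comp, Hom.tateTwist_toLinearMap, Hom.transpose_toLinearMap,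
      LinearMap.dualMap_apply']

/-- Components of `Hom(E, ℚ(n)) → E^∨(n)` (by `rfl`). [cite: Carlson1980, §2(c) Remark (3)] -/
@[simp]
theorem homRightTateToDualTwist_left : (E.homRightTateToDualTwist n).left = homTateRightToDualTwist A n := rfl

/-- Components of `Hom(E, ℚ(n)) → E^∨(n)` (by `rfl`). [cite: Carlson1980, §2(c) Remark (3)] -/
@[simp]
theorem homRightTateToDualTwist_right : (E.homRightTateToDualTwist n).right = homTateRightToDualTwist B n := rfl

/-- **`(Hom(ℚ(n), B) ≅ B(−n))_* Hom(ℚ(n), E) ≡ (Hom(ℚ(n), A) ≅ A(−n))^* E(−n)`.**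
[cite: MacLane1963Homology, Ch. III Prop. 1.8] [cite: DeligneHodgeII1971, 2.1.13] -/
theorem nonempty_congruence_homLeft_tate_pushout_tateTwist_pullback :
    Nonempty (Congruence ((E.homLeft (tate n).toMixedHodgeStructure).pushout (homTateToTwist B n))
      ((E.tateTwist (-n)).pullback (homTateToTwist A n))) :=
  nonempty_congruence_pushout_pullback_of_morphism (E.homLeftTateToTwist n)

/-- **`(Hom(A, ℚ(n)) = A^∨(n))_* Hom(E, ℚ(n)) ≡ (Hom(B, ℚ(n)) = B^∨(n))^* E^∨(n)`.**
[cite: MacLane1963Homology, Ch. III Prop. 1.8] [cite: Carlson1980, §2(c) Remark (3)] -/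
theorem nonempty_congruence_homRight_tate_pushout_dual_tateTwist_pullback :
    Nonempty (Congruence ((E.homRight (tate n).toMixedHodgeStructure).pushout (homTateRightToDualTwist A n))
      ((E.dual.tateTwist n).pullback (homTateRightToDualTwist B n))) :=
  nonempty_congruence_pushout_pullback_of_morphism (E.homRightTateToDualTwist n)

/-- In the complete invariant: `(≅)_* [Hom(ℚ(n), E)]_W = (≅)^* [E(−n)]_W`. [cite: MacLane1963Homology, Ch. III Prop. 1.8] -/
theorem postcomp_clsW_homLeft_tate_eq_precomp_clsW_tateTwist :
    JHomW.postcomp (hom (tate n).toMixedHodgeStructure A) (homTateToTwist B n)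
        (E.homLeft (tate n).toMixedHodgeStructure).clsW =
      JHomW.precomp (B.tateTwist (-n)) (homTateToTwist A n) (E.tateTwist (-n)).clsW :=
  (E.homLeftTateToTwist n).postcomp_clsW_eq_precomp_clsW

/-- In the complete invariant: `(≅)_* [Hom(E, ℚ(n))]_W = (≅)^* [E^∨(n)]_W`. [cite: MacLane1963Homology, Ch. III Prop. 1.8] -/
theorem postcomp_clsW_homRight_tate_eq_precomp_clsW_dual_tateTwist :
    JHomW.postcomp (hom B (tate n).toMixedHodgeStructure) (homTateRightToDualTwist A n)
        (E.homRight (tate n).toMixedHodgeStructure).clsW =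
      JHomW.precomp (A.dual.tateTwist n) (homTateRightToDualTwist B n) (E.dual.tateTwist n).clsW :=
  (E.homRightTateToDualTwist n).postcomp_clsW_eq_precomp_clsW

/-- **`Hom(ℚ(n), E)` splits iff `E` splits.** [cite: DeligneHodgeII1971, 2.1.13] [cite: MacLane1963Homology, Ch. III Prop. 1.8] -/
theorem isSplit_homLeft_tate_iff : (E.homLeft (tate n).toMixedHodgeStructure).IsSplit ↔ E.IsSplit := by
  rw [← E.isSplit_tateTwist_iff (-n), ← Ext.mkOfW_eq_zeroW_iff, ← Ext.mkOfW_eq_zeroW_iff]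
  have h := Ext.pushoutMapW_mkOfW_eq_pullbackMapW_mkOfW (E.homLeftTateToTwist n)
  rw [homLeftTateToTwist_left, homLeftTateToTwist_right] at h
  constructor
  · intro h0
    have h1 : Ext.pullbackMapW (homTateToTwist A n) (Ext.mkOfW (E.tateTwist (-n))) = Ext.zeroW := by
      rw [← h, h0, Ext.pushoutMapW_zeroW]
    have h2 := congrArg (Ext.pullbackMapW (twistToHomTate A n)) h1
    rwa [Ext.pullbackMapW_pullbackMapW_of_comp_eq_id _ _ (homTateToTwist_comp_twistToHomTate A n),
      Ext.pullbackMapW_zeroW] at h2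
  · intro h0
    have h1 : Ext.pushoutMapW (homTateToTwist B n) (Ext.mkOfW (E.homLeft (tate n).toMixedHodgeStructure)) =
        Ext.zeroW := by
      rw [h, h0, Ext.pullbackMapW_zeroW]
    have h2 := congrArg (Ext.pushoutMapW (twistToHomTate B n)) h1
    rwa [Ext.pushoutMapW_pushoutMapW_of_comp_eq_id _ _ (twistToHomTate_comp_homTateToTwist B n),
      Ext.pushoutMapW_zeroW] at h2

/-- **`Hom(E, ℚ(n))` splits iff `E` splits.** [cite: Carlson1980, §2(c) Remark (3)] [cite: MacLane1963Homology, Ch. III Prop. 1.8] -/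
theorem isSplit_homRight_tate_iff : (E.homRight (tate n).toMixedHodgeStructure).IsSplit ↔ E.IsSplit := by
  rw [← E.isSplit_dual_iff, ← E.dual.isSplit_tateTwist_iff n, ← Ext.mkOfW_eq_zeroW_iff, ← Ext.mkOfW_eq_zeroW_iff]
  have h := Ext.pushoutMapW_mkOfW_eq_pullbackMapW_mkOfW (E.homRightTateToDualTwist n)
  rw [homRightTateToDualTwist_left, homRightTateToDualTwist_right] at h
  constructor
  · intro h0
    have h1 : Ext.pullbackMapW (homTateRightToDualTwist B n) (Ext.mkOfW (E.dual.tateTwist n)) = Ext.zeroW := by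
      rw [← h, h0, Ext.pushoutMapW_zeroW]
    have h2 := congrArg (Ext.pullbackMapW (dualTwistToHomTateRight B n)) h1
    rwa [Ext.pullbackMapW_pullbackMapW_of_comp_eq_id _ _
      (homTateRightToDualTwist_comp_dualTwistToHomTateRight B n), Ext.pullbackMapW_zeroW] at h2
  · intro h0
    have h1 : Ext.pushoutMapW (homTateRightToDualTwist A n)
        (Ext.mkOfW (E.homRight (tate n).toMixedHodgeStructure)) = Ext.zeroW := by
      rw [h, h0, Ext.pullbackMapW_zeroW]
    have h2 := congrArg (Ext.pushoutMapW (dualTwistToHomTateRight A n)) h1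
    rwa [Ext.pushoutMapW_pushoutMapW_of_comp_eq_id _ _
      (dualTwistToHomTateRight_comp_homTateRightToDualTwist A n), Ext.pushoutMapW_zeroW] at h2

end Extension

/-! ### §3 On `Ext` -/

namespace Ext

variable (n : ℤ)

/-- **`(Hom(ℚ(n), B) ≅ B(−n))_* Hom(ℚ(n), x) = (Hom(ℚ(n), A) ≅ A(−n))^* x(−n)`** on `Ext`
(`x(−n) = Ext.tateTwistEquiv (-n) x`). [cite: DeligneHodgeII1971, 2.1.13] [cite: MacLane1963Homology, Ch. III Prop. 1.8] -/
theorem pushoutMapW_homTateToTwist_homLeftMap (x : Ext A B) :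
    pushoutMapW (homTateToTwist B n) (homLeftMap (tate n).toMixedHodgeStructure x) =
      pullbackMapW (homTateToTwist A n) (tateTwistEquiv (-n) x) := by
  obtain ⟨E, rfl⟩ := exists_mkOfW_eq x
  rw [homLeftMap_mkOfW, tateTwistEquiv_mkOfW]
  exact pushoutMapW_mkOfW_eq_pullbackMapW_mkOfW (E.homLeftTateToTwist n)

/-- **`Hom(ℚ(n), x) = (Hom(ℚ(n), A) ≅ A(−n))^* (B(−n) ≅ Hom(ℚ(n), B))_* x(−n)`.** [cite: DeligneHodgeII1971, 2.1.13] -/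
theorem homLeftMap_tate_eq (x : Ext A B) :
    homLeftMap (tate n).toMixedHodgeStructure x =
      pullbackMapW (homTateToTwist A n) (pushoutMapW (twistToHomTate B n) (tateTwistEquiv (-n) x)) := by
  rw [← pushoutMapW_pullbackMapW, ← pushoutMapW_homTateToTwist_homLeftMap,
    pushoutMapW_pushoutMapW_of_comp_eq_id _ _ (twistToHomTate_comp_homTateToTwist B n)]

/-- **`x(−n) = (A(−n) ≅ Hom(ℚ(n), A))^* (Hom(ℚ(n), B) ≅ B(−n))_* Hom(ℚ(n), x)`.** [cite: DeligneHodgeII1971, 2.1.13] -/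
theorem tateTwistEquiv_neg_eq_homLeftMap_tate (x : Ext A B) :
    tateTwistEquiv (-n) x =
      pullbackMapW (twistToHomTate A n)
        (pushoutMapW (homTateToTwist B n) (homLeftMap (tate n).toMixedHodgeStructure x)) := by
  rw [pushoutMapW_homTateToTwist_homLeftMap,
    pullbackMapW_pullbackMapW_of_comp_eq_id _ _ (homTateToTwist_comp_twistToHomTate A n)]

/-- **`Hom(ℚ(n), −)` is injective on `Ext(A, B)`.** [cite: DeligneHodgeII1971, 2.1.13] -/
theorem homLeftMap_tate_injective :
    Function.Injective (homLeftMap (A := A) (B := B) (tate n).toMixedHodgeStructure) := by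
  intro x y h
  apply (tateTwistEquiv (A := A) (B := B) (-n)).injective
  rw [tateTwistEquiv_neg_eq_homLeftMap_tate n x, tateTwistEquiv_neg_eq_homLeftMap_tate n y, h]

/-- `Hom(ℚ(n), x)` splits iff `x` splits. [cite: DeligneHodgeII1971, 2.1.13] -/
theorem homLeftMap_tate_eq_zeroW_iff (x : Ext A B) :
    homLeftMap (tate n).toMixedHodgeStructure x = zeroW ↔ x = zeroW := by
  obtain ⟨E, rfl⟩ := exists_mkOfW_eq x
  rw [homLeftMap_mkOfW, mkOfW_eq_zeroW_iff, mkOfW_eq_zeroW_iff, Extension.isSplit_homLeft_tate_iff]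

/-- **`(Hom(A, ℚ(n)) = A^∨(n))_* Hom(x, ℚ(n)) = (Hom(B, ℚ(n)) = B^∨(n))^* x^∨(n)`** on `Ext`
(`x^∨(n) = Ext.tateTwistEquiv n (Ext.dualEquivW x)`). [cite: Carlson1980, §2(c) Remark (3)]
[cite: MacLane1963Homology, Ch. III Prop. 1.8] -/
theorem pushoutMapW_homTateRightToDualTwist_homRightMap (x : Ext A B) :
    pushoutMapW (homTateRightToDualTwist A n) (homRightMap (tate n).toMixedHodgeStructure x) =
      pullbackMapW (homTateRightToDualTwist B n) (tateTwistEquiv n (dualEquivW x)) := by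
  obtain ⟨E, rfl⟩ := exists_mkOfW_eq x
  rw [homRightMap_mkOfW, dualEquivW_mkOfW, tateTwistEquiv_mkOfW]
  exact pushoutMapW_mkOfW_eq_pullbackMapW_mkOfW (E.homRightTateToDualTwist n)

/-- **`Hom(x, ℚ(n)) = (A^∨(n) = Hom(A, ℚ(n)))_* (Hom(B, ℚ(n)) = B^∨(n))^* x^∨(n)`.** [cite: Carlson1980, §2(c) Remark (3)] -/
theorem homRightMap_tate_eq (x : Ext A B) :
    homRightMap (tate n).toMixedHodgeStructure x =
      pushoutMapW (dualTwistToHomTateRight A n)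
        (pullbackMapW (homTateRightToDualTwist B n) (tateTwistEquiv n (dualEquivW x))) := by
  rw [← pushoutMapW_homTateRightToDualTwist_homRightMap,
    pushoutMapW_pushoutMapW_of_comp_eq_id _ _ (dualTwistToHomTateRight_comp_homTateRightToDualTwist A n)]

/-- **`x^∨(n) = (B^∨(n) = Hom(B, ℚ(n)))^* (Hom(A, ℚ(n)) = A^∨(n))_* Hom(x, ℚ(n))`.** [cite: Carlson1980, §2(c) Remark (3)] -/
theorem tateTwistEquiv_dualEquivW_eq_homRightMap_tate (x : Ext A B) :
    tateTwistEquiv n (dualEquivW x) =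
      pullbackMapW (dualTwistToHomTateRight B n)
        (pushoutMapW (homTateRightToDualTwist A n) (homRightMap (tate n).toMixedHodgeStructure x)) := by
  rw [pushoutMapW_homTateRightToDualTwist_homRightMap,
    pullbackMapW_pullbackMapW_of_comp_eq_id _ _ (homTateRightToDualTwist_comp_dualTwistToHomTateRight B n)]

/-- **`Hom(−, ℚ(n))` is injective on `Ext(A, B)`.** [cite: Carlson1980, §2(c) Remark (3)] -/
theorem homRightMap_tate_injective :
    Function.Injective (homRightMap (A := A) (B := B) (tate n).toMixedHodgeStructure) := by
  intro x y h
  apply (dualEquivW (A := A) (B := B)).injective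
  apply (tateTwistEquiv (A := B.dual) (B := A.dual) n).injective
  rw [tateTwistEquiv_dualEquivW_eq_homRightMap_tate n x, tateTwistEquiv_dualEquivW_eq_homRightMap_tate n y, h]

/-- `Hom(x, ℚ(n))` splits iff `x` splits. [cite: Carlson1980, §2(c) Remark (3)] -/
theorem homRightMap_tate_eq_zeroW_iff (x : Ext A B) :
    homRightMap (tate n).toMixedHodgeStructure x = zeroW ↔ x = zeroW := by
  obtain ⟨E, rfl⟩ := exists_mkOfW_eq x
  rw [homRightMap_mkOfW, mkOfW_eq_zeroW_iff, mkOfW_eq_zeroW_iff, Extension.isSplit_homRight_tate_iff]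

end Ext

end Extensions

end MixedHodgeStructure

end Literature.AlgebraicGeometry.Motives

end
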